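import Literature.Geometry.Kaehler.ComplexTorusHodgeGeneralIntrinsicHodgeGroup
import HarnessLib

/-!
# A Hodge-general abelian variety against a factor of the SAME (or smaller) dimension that is NOT Hodge-general:
# `Hg` splits, `Hom = 0`, `ρ = 1 + ρ(X₂)`, condition (D); abelian fourfolds `S₁ × S₂` (`S₁` Hodge-general surface, `S₂` any abelian
# surface with `End_ℚ(S₂) ≠ ℚ` or `S₂ ∼ S₁`: Moonen–Zarhin Thm. (0.2)(4)); `T₁ × T₂` for threefolds

Layer `Literature/Geometry/Kaehler`, namespace `Literature.Geometry.Kaehler.ComplexTorus`; lane `lit-hodgefound`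
(Track 2, Layer A4), seat `lit-hodgefound-skel-4`, row A4-130 of `run/shared/lean/pub/lit-hodgefound/SKELETON.md`.
THEOREMS ONLY (no `def`, no named fact, no instance, no notation; net debt `0`).

THE POINT. Rows A4-128/129 give, for a Hodge-general abelian variety `X₁` (`End_ℚ(X₁) = ℚ` and (D) on all powers, any
presentation), the splitting `Hg(X₁ × X₂)(ℂ) = Hg(X₁)(ℂ) × Hg(X₂)(ℂ)` and its consequences as soon as
`dim Hg(X₂) < g₁(2g₁+1)`. Row A4-129 §1 also gives `dim Hg(X₂) ≤ g₂(2g₂+1)` for EVERY abelian variety, with `<` iff `X₂`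
is not Hodge-general (`(∃ k p, Dᵖ(X₂ᵏ) ≠ Bᵖ(X₂ᵏ)) ∨ End_ℚ(X₂) ≠ ℚ`). Hence the hypothesis is automatic in two situations
not covered by the numerical bound `(2g₂)² ≤ g₁(2g₁+1)` of A4-128:

* §1 **`dim X₂ < dim X₁`** (no further hypothesis on the abelian variety `X₂`; e.g. `g₂ = g₁ − 1 ≥ 4`, where
  `(2g₂)² > g₁(2g₁+1)`), and **`dim X₂ ≤ dim X₁` with `End_ℚ(X₂) ≠ ℚ`** — in particular the SAME dimension: `Hg` splits
  (complex and real points), `Hom_ℚ(X₁, X₂) = 0 = Hom_ℚ(X₂, X₁)`, `ρ(X₁ × X₂) = 1 + ρ(X₂)`, and (D) on all powers of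
  `X₁ × X₂` as soon as `X₂` satisfies (D); if instead `X₂ ∼ X₁` then `X₁ × X₂ ∼ X₁²` satisfies (D) (Hazama's second remark);
* §2 **ABELIAN FOURFOLDS `S₁ × S₂`, `S₁` a Hodge-general abelian surface** (`End_ℚ(S₁) = ℚ`; every abelian surface satisfies
  (D), Moonen–Zarhin §3): for EVERY abelian surface `S₂` with `End_ℚ(S₂) ≠ ℚ` (CM, real or quaternion multiplication,
  `E × E'`, …) — `Hg(S₁ × S₂) = Hg(S₁) × Hg(S₂)`, `Hom = 0`, `ρ = 1 + ρ(S₂)`, (D) on all powers, the cycle form `A = B` — and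
  for `S₂ ∼ S₁` — (D) on all powers. This is Thm. (0.2)(4) ("Suppose we are not in one of the cases (a), (b), (c) or (d).
  Then `Hg(X) = Sp_D(V,φ)` and `B•(Xⁿ) = D•(Xⁿ)`") for these non-simple fourfolds; NOT covered here (and not claimed): `S₂`
  Hodge-general and not isogenous to `S₁` (needs Hazama's Thm. (3.2)(1) / the representation-theoretic Lemma (3.6)), and
  `S₁` not Hodge-general (Moonen–Zarhin §4–§5);
* §3 two abelian threefolds `T₁`, `T₂` with `End_ℚ(T₁) = ℚ ≠ End_ℚ(T₂)`: `Hg` splits, `Hom = 0`, `ρ(T₁ × T₂) = 1 + ρ(T₂)`, and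
  (D) for the sixfold `T₁ × T₂` whenever `T₂` satisfies (D).

## Sources, verbatim

* B. Moonen, Yu. G. Zarhin [held arXiv:math/9901113]: Thm. (0.2) [p0001 L124–L152] cases (a)–(d) and "(4) Suppose we are
  not in one of the cases (a), (b), (c) or (d). Then `Hg(X) = Sp_D(V,φ)` and `B•(Xⁿ) = D•(Xⁿ)` for all `n`."; §1 [p0002
  L123–L132] "`Hg(X) ⊂ Sp_D(V,φ)`"; §1 (1.5) (condition (D)); §3 (3.1) [p0006 L52–L60], Thm. (3.2) (Hazama), Prop. (3.8); §3
  [p0008 L108–L111] (every abelian surface satisfies (D)).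
* B. B. Gordon, survey (1997/1999), §2.16 Proposition, Thm. 7.5, 7.6.1 ("if `A` is stably nondegenerate then so is any
  power of `A`"), Thm. 7.6.2; H. Lange (2023), §7.3.1 Prop. 7.3.2, §7.3.3 Exercise (1)(b), §2.4.4 Cor. 2.4.26; K. Hulek,
  R. Laface (2019), §2.1 Cor. 2.3.

## References

* [MoonenZarhin1999LowDim] B. Moonen, Yu. G. Zarhin, Math. Ann. 315 (1999) 711–733, Thm. (0.2), §1, §3.
* [Gordon1997] B. B. Gordon, arXiv:alg-geom/9709030, §2.16 Proposition, 7.5, 7.6.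
* [Gordon1999HodgeAVSurvey] the same, Appendix B in J. D. Lewis (1999).
* [Lange2023AbelianVarietiesComplex] H. Lange, Springer (2023), §7.3.1 Prop. 7.3.2, §7.3.3 Exercise (1)(b), §2.4.4 Cor. 2.4.26.
* [HulekLaface2019PicardNumbersAV] K. Hulek, R. Laface, Ann. Sc. Norm. Super. Pisa (2019), §2.1 Cor. 2.3.
-/

noncomputable section

open Module Matrix Set Function
open Literature.NumberTheory.Automorphic (IsZConnected lieAlgebraGL lieSubalgebraGL)

universe u

namespace Literature.Geometry.Kaehler

namespace ComplexTorus

/-- A complex torus of positive dimension has a non-empty lattice index type. [cite: Lange2023AbelianVarietiesComplex, §1.1.2 (p. 18)] -/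
private theorem nonempty_of_finrank_pos₁₃₀ {ι : Type*} [Fintype ι] {E : Type*} [NormedAddCommGroup E] [NormedSpace ℂ E]
    [FiniteDimensional ℂ E] (Φ : (ι → ℝ) ≃L[ℝ] E) (h : 0 < finrank ℂ E) : Nonempty ι := by
  have hc := card_eq_two_mul_finrank Φ
  exact Fintype.card_pos_iff.1 (by omega)

/-- `g ↦ g(2g+1)` is monotone. [folklore] -/
private theorem mul_two_mul_add_one_le_of_le₁₃₀ {a b : ℕ} (h : a ≤ b) : a * (2 * a + 1) ≤ b * (2 * b + 1) := by
  nlinarith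

/-- `g ↦ g(2g+1)` is strictly monotone. [folklore] -/
private theorem mul_two_mul_add_one_lt_of_lt₁₃₀ {a b : ℕ} (h : a < b) : a * (2 * a + 1) < b * (2 * b + 1) := by
  nlinarith

/-! ## §1 `X₂` of dimension `≤ dim X₁` and not Hodge-general (or of smaller dimension, or isogenous to `X₁`) -/

section SameDimension

variable {ι₁ ι₂ : Type*} [Fintype ι₁] [DecidableEq ι₁] [Nonempty ι₁] [Fintype ι₂] [DecidableEq ι₂]
  {E₁ E₂ : Type*} [NormedAddCommGroup E₁] [NormedSpace ℂ E₁] [FiniteDimensional ℂ E₁] [NormedAddCommGroup E₂]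
  [NormedSpace ℂ E₂] [FiniteDimensional ℂ E₂] {Φ₁ : (ι₁ → ℝ) ≃L[ℝ] E₁} (Φ₂ : (ι₂ → ℝ) ≃L[ℝ] E₂)

/-- **An abelian variety with `End_ℚ(X) ≠ ℚ` has `dim Hg(X) < g(2g+1)`** (`Hg(X) ⊂ Sp_D(V,φ)`, the centraliser of
`D = End⁰(X)`; here from row A4-129's `dim Hg(X) = g(2g+1) ⟺ (D) ∧ End_ℚ(X) = ℚ`).
[cite: MoonenZarhin1999LowDim, §1 (p0002 L123–L132)] [cite: Gordon1999HodgeAVSurvey, Thm. 7.5] [cite: Lange2023AbelianVarietiesComplex, §7.3.1 Prop. 7.3.2] -/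
theorem IsAbelianVariety.zdim_map_toGL_hodgeGroupC_lt_of_endAlgRat_ne_bot [Nonempty ι₂] (hA₂ : IsAbelianVariety Φ₂) (hE₂ : endAlgRat Φ₂ ≠ ⊥) :
    (isZConnected_map_toGL_hodgeGroupC Φ₂).zdim < finrank ℂ E₂ * (2 * finrank ℂ E₂ + 1) :=
  (hA₂.zdim_map_toGL_hodgeGroupC_lt_iff Φ₂).2 (Or.inr hE₂)

/-- `dim Hg(X₂) < g₁(2g₁+1)` for an abelian variety `X₂` with `End_ℚ(X₂) ≠ ℚ` and `dim X₂ ≤ g₁`.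
[cite: MoonenZarhin1999LowDim, §1 (p0002 L123–L132)] [cite: Gordon1999HodgeAVSurvey, Thm. 7.5] -/
theorem IsAbelianVariety.zdim_map_toGL_hodgeGroupC_lt_of_endAlgRat_ne_bot_of_finrank_le [Nonempty ι₂] (hA₂ : IsAbelianVariety Φ₂)
    (hE₂ : endAlgRat Φ₂ ≠ ⊥) {g₁ : ℕ} (hle : finrank ℂ E₂ ≤ g₁) :
    (isZConnected_map_toGL_hodgeGroupC Φ₂).zdim < g₁ * (2 * g₁ + 1) :=
  lt_of_lt_of_le (hA₂.zdim_map_toGL_hodgeGroupC_lt_of_endAlgRat_ne_bot Φ₂ hE₂) (mul_two_mul_add_one_le_of_le₁₃₀ hle)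

/-- `dim Hg(X₂) < g₁(2g₁+1)` for EVERY abelian variety `X₂` of dimension `< g₁` (`dim Hg(X₂) ≤ g₂(2g₂+1)`).
[cite: MoonenZarhin1999LowDim, §1 (p0002 L123–L132)] [cite: Lange2023AbelianVarietiesComplex, §7.2.1 Prop. 7.2.3] -/
theorem IsAbelianVariety.zdim_map_toGL_hodgeGroupC_lt_of_finrank_lt (hA₂ : IsAbelianVariety Φ₂) {g₁ : ℕ}
    (hlt : finrank ℂ E₂ < g₁) : (isZConnected_map_toGL_hodgeGroupC Φ₂).zdim < g₁ * (2 * g₁ + 1) :=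
  lt_of_le_of_lt (hA₂.zdim_map_toGL_hodgeGroupC_le Φ₂) (mul_two_mul_add_one_lt_of_lt₁₃₀ hlt)

/-- **`Hg(X₁ × X₂)(ℂ) = Hg(X₁)(ℂ) × Hg(X₂)(ℂ)` for `X₁` Hodge-general and `X₂` an abelian variety with `End_ℚ(X₂) ≠ ℚ` of dimension
`≤ dim X₁`** — in particular of the SAME dimension. [cite: MoonenZarhin1999LowDim, §3 (3.1) and Thm. (0.2) (4)] [cite: Gordon1997, §2.16 Proposition] -/
theorem IsAbelianVariety.hodgeGroupC_prod_eq_blockDiagProd_of_endAlgRat_eq_bot_of_endAlgRat_ne_bot [Nonempty ι₂] (hA₁ : IsAbelianVariety Φ₁)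
    (hE₁ : endAlgRat Φ₁ = ⊥) (hX₁ : ∀ k p, divisorClasses (powPeriod Φ₁ k) p = hodgeClasses (powPeriod Φ₁ k) p)
    (hA₂ : IsAbelianVariety Φ₂) (hE₂ : endAlgRat Φ₂ ≠ ⊥) (hle : finrank ℂ E₂ ≤ finrank ℂ E₁) :
    hodgeGroupC (prodPeriod Φ₁ Φ₂) = blockDiagProd (hodgeGroupC Φ₁) (hodgeGroupC Φ₂) :=
  hA₁.hodgeGroupC_prod_eq_blockDiagProd_of_endAlgRat_eq_bot_of_zdim_lt Φ₂ hE₁ hX₁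
    (hA₂.zdim_map_toGL_hodgeGroupC_lt_of_endAlgRat_ne_bot_of_finrank_le Φ₂ hE₂ hle)

/-- **`Hg(X₁ × X₂)(ℂ)` splits for `X₁` Hodge-general and EVERY abelian variety `X₂` of smaller dimension.**
[cite: MoonenZarhin1999LowDim, §3 (3.1)] [cite: Gordon1997, §2.16 Proposition] [cite: Lange2023AbelianVarietiesComplex, §7.3.1 Prop. 7.3.2] -/
theorem IsAbelianVariety.hodgeGroupC_prod_eq_blockDiagProd_of_endAlgRat_eq_bot_of_finrank_lt (hA₁ : IsAbelianVariety Φ₁)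
    (hE₁ : endAlgRat Φ₁ = ⊥) (hX₁ : ∀ k p, divisorClasses (powPeriod Φ₁ k) p = hodgeClasses (powPeriod Φ₁ k) p)
    (hA₂ : IsAbelianVariety Φ₂) (hlt : finrank ℂ E₂ < finrank ℂ E₁) :
    hodgeGroupC (prodPeriod Φ₁ Φ₂) = blockDiagProd (hodgeGroupC Φ₁) (hodgeGroupC Φ₂) :=
  hA₁.hodgeGroupC_prod_eq_blockDiagProd_of_endAlgRat_eq_bot_of_zdim_lt Φ₂ hE₁ hX₁
    (hA₂.zdim_map_toGL_hodgeGroupC_lt_of_finrank_lt Φ₂ hlt)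

/-- Real points: `Hg(X₁ × X₂)(ℝ) = Hg(X₁)(ℝ) × Hg(X₂)(ℝ)` (`X₁` Hodge-general, `End_ℚ(X₂) ≠ ℚ`, `dim X₂ ≤ dim X₁`).
[cite: MoonenZarhin1999LowDim, §3 (3.1)] [cite: Springer1998, §13.3 Cor. 13.3.9 (ii)] -/
theorem IsAbelianVariety.hodgeGroup_prod_eq_of_endAlgRat_eq_bot_of_endAlgRat_ne_bot [Nonempty ι₂] (hA₁ : IsAbelianVariety Φ₁)
    (hE₁ : endAlgRat Φ₁ = ⊥) (hX₁ : ∀ k p, divisorClasses (powPeriod Φ₁ k) p = hodgeClasses (powPeriod Φ₁ k) p)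
    (hA₂ : IsAbelianVariety Φ₂) (hE₂ : endAlgRat Φ₂ ≠ ⊥) (hle : finrank ℂ E₂ ≤ finrank ℂ E₁) :
    hodgeGroup (prodPeriod Φ₁ Φ₂) = ((hodgeGroup Φ₁).prod (hodgeGroup Φ₂)).map (blockDiag ι₁ ι₂) :=
  hodgeGroup_prod_eq_of_hodgeGroupC_prod_eq
    (hA₁.hodgeGroupC_prod_eq_blockDiagProd_of_endAlgRat_eq_bot_of_endAlgRat_ne_bot Φ₂ hE₁ hX₁ hA₂ hE₂ hle)

/-- **`Hom_ℚ(X₁, X₂) = 0 = Hom_ℚ(X₂, X₁)`** for `X₁` Hodge-general and `X₂` abelian with `End_ℚ(X₂) ≠ ℚ`, `dim X₂ ≤ dim X₁`.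
[cite: MoonenZarhin1999LowDim, §3 (3.1) and Prop. (3.8)] [cite: Lange2023AbelianVarietiesComplex, §2.4.4 Cor. 2.4.26] -/
theorem IsAbelianVariety.homRat_eq_bot_and_of_endAlgRat_eq_bot_of_endAlgRat_ne_bot [Nonempty ι₂] (hA₁ : IsAbelianVariety Φ₁)
    (hE₁ : endAlgRat Φ₁ = ⊥) (hX₁ : ∀ k p, divisorClasses (powPeriod Φ₁ k) p = hodgeClasses (powPeriod Φ₁ k) p)
    (hA₂ : IsAbelianVariety Φ₂) (hE₂ : endAlgRat Φ₂ ≠ ⊥) (hle : finrank ℂ E₂ ≤ finrank ℂ E₁) :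
    homRat Φ₁ Φ₂ = ⊥ ∧ homRat Φ₂ Φ₁ = ⊥ :=
  ⟨hA₁.homRat_eq_bot_of_endAlgRat_eq_bot_of_zdim_lt Φ₂ hE₁ hX₁
      (hA₂.zdim_map_toGL_hodgeGroupC_lt_of_endAlgRat_ne_bot_of_finrank_le Φ₂ hE₂ hle),
    hA₁.homRat_eq_bot_of_endAlgRat_eq_bot_of_zdim_lt' Φ₂ hE₁ hX₁
      (hA₂.zdim_map_toGL_hodgeGroupC_lt_of_endAlgRat_ne_bot_of_finrank_le Φ₂ hE₂ hle)⟩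

/-- **`Hom_ℚ(X₁, X₂) = 0 = Hom_ℚ(X₂, X₁)`** for `X₁` Hodge-general and every abelian variety `X₂` of smaller dimension.
[cite: MoonenZarhin1999LowDim, §3 (3.1) and Prop. (3.8)] [cite: Lange2023AbelianVarietiesComplex, §2.4.4 Cor. 2.4.26] -/
theorem IsAbelianVariety.homRat_eq_bot_and_of_endAlgRat_eq_bot_of_finrank_lt (hA₁ : IsAbelianVariety Φ₁)
    (hE₁ : endAlgRat Φ₁ = ⊥) (hX₁ : ∀ k p, divisorClasses (powPeriod Φ₁ k) p = hodgeClasses (powPeriod Φ₁ k) p)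
    (hA₂ : IsAbelianVariety Φ₂) (hlt : finrank ℂ E₂ < finrank ℂ E₁) : homRat Φ₁ Φ₂ = ⊥ ∧ homRat Φ₂ Φ₁ = ⊥ :=
  ⟨hA₁.homRat_eq_bot_of_endAlgRat_eq_bot_of_zdim_lt Φ₂ hE₁ hX₁ (hA₂.zdim_map_toGL_hodgeGroupC_lt_of_finrank_lt Φ₂ hlt),
    hA₁.homRat_eq_bot_of_endAlgRat_eq_bot_of_zdim_lt' Φ₂ hE₁ hX₁ (hA₂.zdim_map_toGL_hodgeGroupC_lt_of_finrank_lt Φ₂ hlt)⟩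

/-- **`ρ(X₁ × X₂) = 1 + ρ(X₂)`** (`X₁` Hodge-general, `X₂` abelian with `End_ℚ(X₂) ≠ ℚ`, `dim X₂ ≤ dim X₁`).
[cite: HulekLaface2019PicardNumbersAV, §2.1 Cor. 2.3] [cite: MoonenZarhin1999LowDim, §3 Prop. (3.8)] -/
theorem IsAbelianVariety.finrank_neronSeveriGroup_prod_of_endAlgRat_eq_bot_of_endAlgRat_ne_bot [Nonempty ι₂] (hA₁ : IsAbelianVariety Φ₁)
    (hE₁ : endAlgRat Φ₁ = ⊥) (hX₁ : ∀ k p, divisorClasses (powPeriod Φ₁ k) p = hodgeClasses (powPeriod Φ₁ k) p)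
    (hA₂ : IsAbelianVariety Φ₂) (hE₂ : endAlgRat Φ₂ ≠ ⊥) (hle : finrank ℂ E₂ ≤ finrank ℂ E₁) :
    finrank ℤ (neronSeveriGroup (prodPeriod Φ₁ Φ₂)) = 1 + finrank ℤ (neronSeveriGroup Φ₂) :=
  hA₁.finrank_neronSeveriGroup_prod_eq_one_add_of_endAlgRat_eq_bot_of_zdim_lt Φ₂ hE₁ hX₁
    (hA₂.zdim_map_toGL_hodgeGroupC_lt_of_endAlgRat_ne_bot_of_finrank_le Φ₂ hE₂ hle)

/-- **`ρ(X₁ × X₂) = 1 + ρ(X₂)`** for `X₁` Hodge-general and every abelian variety `X₂` of smaller dimension.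
[cite: HulekLaface2019PicardNumbersAV, §2.1 Cor. 2.3] [cite: MoonenZarhin1999LowDim, §3 Prop. (3.8)] -/
theorem IsAbelianVariety.finrank_neronSeveriGroup_prod_of_endAlgRat_eq_bot_of_finrank_lt (hA₁ : IsAbelianVariety Φ₁)
    (hE₁ : endAlgRat Φ₁ = ⊥) (hX₁ : ∀ k p, divisorClasses (powPeriod Φ₁ k) p = hodgeClasses (powPeriod Φ₁ k) p)
    (hA₂ : IsAbelianVariety Φ₂) (hlt : finrank ℂ E₂ < finrank ℂ E₁) :
    finrank ℤ (neronSeveriGroup (prodPeriod Φ₁ Φ₂)) = 1 + finrank ℤ (neronSeveriGroup Φ₂) :=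
  hA₁.finrank_neronSeveriGroup_prod_eq_one_add_of_endAlgRat_eq_bot_of_zdim_lt Φ₂ hE₁ hX₁
    (hA₂.zdim_map_toGL_hodgeGroupC_lt_of_finrank_lt Φ₂ hlt)

/-- **(D) on all powers of `X₁ × X₂`**: `X₁` Hodge-general, `X₂` stably nondegenerate abelian with `End_ℚ(X₂) ≠ ℚ` and
`dim X₂ ≤ dim X₁`. [cite: MoonenZarhin1999LowDim, §3 (3.1), Thm. (3.2) (1) and Thm. (0.2) (4)] [cite: Gordon1999HodgeAVSurvey, Thm. 7.5 and Thm. 7.6.2] -/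
theorem IsAbelianVariety.forall_divisorClasses_powPeriod_prod_eq_hodgeClasses_of_endAlgRat_eq_bot_of_endAlgRat_ne_bot [Nonempty ι₂]
    (hA₁ : IsAbelianVariety Φ₁) (hE₁ : endAlgRat Φ₁ = ⊥)
    (hX₁ : ∀ k p, divisorClasses (powPeriod Φ₁ k) p = hodgeClasses (powPeriod Φ₁ k) p) (hA₂ : IsAbelianVariety Φ₂)
    (hE₂ : endAlgRat Φ₂ ≠ ⊥) (hle : finrank ℂ E₂ ≤ finrank ℂ E₁)
    (hX₂ : ∀ k p, divisorClasses (powPeriod Φ₂ k) p = hodgeClasses (powPeriod Φ₂ k) p) :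
    ∀ k p, divisorClasses (powPeriod (prodPeriod Φ₁ Φ₂) k) p = hodgeClasses (powPeriod (prodPeriod Φ₁ Φ₂) k) p :=
  hA₁.forall_divisorClasses_powPeriod_prod_eq_hodgeClasses_of_endAlgRat_eq_bot_of_zdim_lt Φ₂ hE₁ hX₁
    (hA₂.zdim_map_toGL_hodgeGroupC_lt_of_endAlgRat_ne_bot_of_finrank_le Φ₂ hE₂ hle) hX₂

/-- **(D) on all powers of `X₁ × X₂`**: `X₁` Hodge-general, `X₂` any stably nondegenerate abelian variety of smaller
dimension. [cite: MoonenZarhin1999LowDim, §3 (3.1) and Thm. (3.2) (1)] [cite: Gordon1999HodgeAVSurvey, Thm. 7.5 and Thm. 7.6.2] -/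
theorem IsAbelianVariety.forall_divisorClasses_powPeriod_prod_eq_hodgeClasses_of_endAlgRat_eq_bot_of_finrank_lt
    (hA₁ : IsAbelianVariety Φ₁) (hE₁ : endAlgRat Φ₁ = ⊥)
    (hX₁ : ∀ k p, divisorClasses (powPeriod Φ₁ k) p = hodgeClasses (powPeriod Φ₁ k) p) (hA₂ : IsAbelianVariety Φ₂)
    (hlt : finrank ℂ E₂ < finrank ℂ E₁) (hX₂ : ∀ k p, divisorClasses (powPeriod Φ₂ k) p = hodgeClasses (powPeriod Φ₂ k) p) :
    ∀ k p, divisorClasses (powPeriod (prodPeriod Φ₁ Φ₂) k) p = hodgeClasses (powPeriod (prodPeriod Φ₁ Φ₂) k) p :=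
  hA₁.forall_divisorClasses_powPeriod_prod_eq_hodgeClasses_of_endAlgRat_eq_bot_of_zdim_lt Φ₂ hE₁ hX₁
    (hA₂.zdim_map_toGL_hodgeGroupC_lt_of_finrank_lt Φ₂ hlt) hX₂

omit [Nonempty ι₁] [FiniteDimensional ℂ E₁] [FiniteDimensional ℂ E₂] in
/-- **`X₂ ∼ X₁` with `X₁` stably nondegenerate ⟹ (D) on all powers of `X₁ × X₂`** (`X₁ × X₂ ∼ X₁²`; "if `A` is stably
nondegenerate then so is any power of `A`", and (D) is an isogeny invariant) — no `End_ℚ` hypothesis.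
[cite: Gordon1999HodgeAVSurvey, 7.6.1] [cite: Lange2023AbelianVarietiesComplex, §7.3.3 Exercise (1)(b) and §1.1.2 Cor. 1.1.16] -/
theorem IsIsogenous.forall_divisorClasses_powPeriod_prod_eq_hodgeClasses_of_forall_powPeriod_left (h : IsIsogenous Φ₂ Φ₁)
    (hX₁ : ∀ k p, divisorClasses (powPeriod Φ₁ k) p = hodgeClasses (powPeriod Φ₁ k) p) :
    ∀ k p, divisorClasses (powPeriod (prodPeriod Φ₁ Φ₂) k) p = hodgeClasses (powPeriod (prodPeriod Φ₁ Φ₂) k) p :=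
  ((IsIsogenous.refl Φ₁).prod_powPeriod_two h).forall_powPeriod_divisorClasses_eq_hodgeClasses_of_powPeriod hX₁

variable {κ : Type*} [Fintype κ] [DecidableEq κ] {E' : Type u} [NormedAddCommGroup E'] [InnerProductSpace ℂ E']
  [FiniteDimensional ℂ E'] [MeasurableSpace E'] [BorelSpace E'] (Ψ : (κ → ℝ) ≃L[ℝ] E') {q : ℕ} (e : Fin q ≃ κ)

/-- **The cycle form**: every inner-product torus `Y ∼ (X₁ × X₂)ᵏ` — `X₁` Hodge-general, `X₂` stably nondegenerate abelian with
`End_ℚ(X₂) ≠ ℚ`, `dim X₂ ≤ dim X₁` — satisfies `Aᵖ(Y) = Bᵖ(Y)` in every codimension.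
[cite: MoonenZarhin1999LowDim, §1 (1.5) and Thm. (0.2) (4)] [cite: Lange2023AbelianVarietiesComplex, §7.3.1 (p. 336) and §7.3.3 Exercise (1)(b)] -/
theorem IsIsogenous.forall_analyticClasses_eq_hodgeClasses_of_powPeriod_prod_of_endAlgRat_eq_bot_of_endAlgRat_ne_bot [Nonempty ι₂] {k : ℕ}
    (hY : IsIsogenous Ψ (powPeriod (prodPeriod Φ₁ Φ₂) k)) (hA₁ : IsAbelianVariety Φ₁) (hE₁ : endAlgRat Φ₁ = ⊥)
    (hX₁ : ∀ k p, divisorClasses (powPeriod Φ₁ k) p = hodgeClasses (powPeriod Φ₁ k) p) (hA₂ : IsAbelianVariety Φ₂)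
    (hE₂ : endAlgRat Φ₂ ≠ ⊥) (hle : finrank ℂ E₂ ≤ finrank ℂ E₁)
    (hX₂ : ∀ k p, divisorClasses (powPeriod Φ₂ k) p = hodgeClasses (powPeriod Φ₂ k) p) (p : ℕ) :
    analyticClasses Ψ e p = hodgeClasses Ψ p :=
  hY.forall_analyticClasses_eq_hodgeClasses_of_powPeriod_of_forall_powPeriod Ψ e (hA₁.prod hA₂)
    (hA₁.forall_divisorClasses_powPeriod_prod_eq_hodgeClasses_of_endAlgRat_eq_bot_of_endAlgRat_ne_bot Φ₂ hE₁ hX₁ hA₂ hE₂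
      hle hX₂) p

end SameDimension

/-! ## §2 Abelian fourfolds `S₁ × S₂`, `S₁` a Hodge-general abelian surface (Moonen–Zarhin Thm. (0.2)(4), product case) -/

section Surfaces

variable {ι₁ ι₂ : Type} [Fintype ι₁] [DecidableEq ι₁] [Fintype ι₂] [DecidableEq ι₂]
  {E₁ E₂ : Type} [NormedAddCommGroup E₁] [NormedSpace ℂ E₁] [FiniteDimensional ℂ E₁] [NormedAddCommGroup E₂]
  [NormedSpace ℂ E₂] [FiniteDimensional ℂ E₂] {Φ₁ : (ι₁ → ℝ) ≃L[ℝ] E₁} (Φ₂ : (ι₂ → ℝ) ≃L[ℝ] E₂)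

/-- **`S₁` AN ABELIAN SURFACE WITH `End_ℚ(S₁) = ℚ`, `S₂` ANY ABELIAN SURFACE WITH `End_ℚ(S₂) ≠ ℚ` (CM, real or quaternion
multiplication, isogenous to a product of elliptic curves, …): every power of the abelian fourfold `S₁ × S₂` has its Hodge ring
generated by divisor classes** (both surfaces satisfy (D), Moonen–Zarhin §3; `Hg(S₁) = Sp₄`, `dim Hg(S₂) < 10`).
[cite: MoonenZarhin1999LowDim, Thm. (0.2) (4) (p0001 L124–L152), §3 (3.1), Thm. (3.2) (1) and §3 (p0008 L108–L111)]
[cite: Gordon1999HodgeAVSurvey, Thm. 7.5 and Thm. 7.6.2] -/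
theorem IsAbelianVariety.forall_divisorClasses_powPeriod_prod_eq_hodgeClasses_of_finrank_eq_two_of_endAlgRat_eq_bot_of_ne_bot
    (hS₁ : IsAbelianVariety Φ₁) (h2₁ : finrank ℂ E₁ = 2) (hE₁ : endAlgRat Φ₁ = ⊥) (hS₂ : IsAbelianVariety Φ₂)
    (h2₂ : finrank ℂ E₂ = 2) (hE₂ : endAlgRat Φ₂ ≠ ⊥) :
    ∀ k p, divisorClasses (powPeriod (prodPeriod Φ₁ Φ₂) k) p = hodgeClasses (powPeriod (prodPeriod Φ₁ Φ₂) k) p := by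
  haveI := nonempty_of_finrank_pos₁₃₀ Φ₁ (by omega)
  haveI := nonempty_of_finrank_pos₁₃₀ Φ₂ (by omega)
  exact hS₁.forall_divisorClasses_powPeriod_prod_eq_hodgeClasses_of_endAlgRat_eq_bot_of_endAlgRat_ne_bot Φ₂ hE₁
    (hS₁.forall_divisorClasses_powPeriod_eq_hodgeClasses_of_finrank_eq_two h2₁) hS₂ hE₂ (by omega)
    (hS₂.forall_divisorClasses_powPeriod_eq_hodgeClasses_of_finrank_eq_two h2₂)

/-- **`Hg(S₁ × S₂)(ℂ) = Hg(S₁)(ℂ) × Hg(S₂)(ℂ)`** for such a pair of abelian surfaces ("`Hg(X) = Hg(Y₁^{m₁}) × ⋯`").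
[cite: MoonenZarhin1999LowDim, Thm. (0.2) (4) and §3 (3.1)] [cite: Gordon1997, §2.16 Proposition] -/
theorem IsAbelianVariety.hodgeGroupC_prod_eq_blockDiagProd_of_finrank_eq_two_of_endAlgRat_eq_bot_of_ne_bot
    (hS₁ : IsAbelianVariety Φ₁) (h2₁ : finrank ℂ E₁ = 2) (hE₁ : endAlgRat Φ₁ = ⊥) (hS₂ : IsAbelianVariety Φ₂)
    (h2₂ : finrank ℂ E₂ = 2) (hE₂ : endAlgRat Φ₂ ≠ ⊥) :
    hodgeGroupC (prodPeriod Φ₁ Φ₂) = blockDiagProd (hodgeGroupC Φ₁) (hodgeGroupC Φ₂) := by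
  haveI := nonempty_of_finrank_pos₁₃₀ Φ₁ (by omega)
  haveI := nonempty_of_finrank_pos₁₃₀ Φ₂ (by omega)
  exact hS₁.hodgeGroupC_prod_eq_blockDiagProd_of_endAlgRat_eq_bot_of_endAlgRat_ne_bot Φ₂ hE₁
    (hS₁.forall_divisorClasses_powPeriod_eq_hodgeClasses_of_finrank_eq_two h2₁) hS₂ hE₂ (by omega)

/-- **`Hom_ℚ(S₁, S₂) = 0 = Hom_ℚ(S₂, S₁)` and `ρ(S₁ × S₂) = 1 + ρ(S₂)`** for such a pair (so `ρ ∈ {2, 3, 4, 5}`).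
[cite: HulekLaface2019PicardNumbersAV, §2.1 Cor. 2.3] [cite: MoonenZarhin1999LowDim, §3 Prop. (3.8)] -/
theorem IsAbelianVariety.homRat_eq_bot_and_finrank_neronSeveriGroup_prod_of_finrank_eq_two_of_endAlgRat_eq_bot_of_ne_bot
    (hS₁ : IsAbelianVariety Φ₁) (h2₁ : finrank ℂ E₁ = 2) (hE₁ : endAlgRat Φ₁ = ⊥) (hS₂ : IsAbelianVariety Φ₂)
    (h2₂ : finrank ℂ E₂ = 2) (hE₂ : endAlgRat Φ₂ ≠ ⊥) :
    (homRat Φ₁ Φ₂ = ⊥ ∧ homRat Φ₂ Φ₁ = ⊥) ∧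
      finrank ℤ (neronSeveriGroup (prodPeriod Φ₁ Φ₂)) = 1 + finrank ℤ (neronSeveriGroup Φ₂) := by
  haveI := nonempty_of_finrank_pos₁₃₀ Φ₁ (by omega)
  haveI := nonempty_of_finrank_pos₁₃₀ Φ₂ (by omega)
  have hD₁ := hS₁.forall_divisorClasses_powPeriod_eq_hodgeClasses_of_finrank_eq_two h2₁
  exact ⟨hS₁.homRat_eq_bot_and_of_endAlgRat_eq_bot_of_endAlgRat_ne_bot Φ₂ hE₁ hD₁ hS₂ hE₂ (by omega),
    hS₁.finrank_neronSeveriGroup_prod_of_endAlgRat_eq_bot_of_endAlgRat_ne_bot Φ₂ hE₁ hD₁ hS₂ hE₂ (by omega)⟩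

omit [FiniteDimensional ℂ E₂] in
/-- **`S₂ ∼ S₁` (`S₁` any abelian surface): (D) on all powers of `S₁ × S₂`** (`∼ S₁²`).
[cite: MoonenZarhin1999LowDim, §3 (p0008 L108–L111) and §1 (1.5)] [cite: Gordon1999HodgeAVSurvey, 7.6.1] -/
theorem IsIsogenous.forall_divisorClasses_powPeriod_prod_eq_hodgeClasses_of_finrank_eq_two (h : IsIsogenous Φ₂ Φ₁)
    (hS₁ : IsAbelianVariety Φ₁) (h2₁ : finrank ℂ E₁ = 2) :
    ∀ k p, divisorClasses (powPeriod (prodPeriod Φ₁ Φ₂) k) p = hodgeClasses (powPeriod (prodPeriod Φ₁ Φ₂) k) p := by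
  haveI := nonempty_of_finrank_pos₁₃₀ Φ₁ (by omega)
  exact h.forall_divisorClasses_powPeriod_prod_eq_hodgeClasses_of_forall_powPeriod_left Φ₂
    (hS₁.forall_divisorClasses_powPeriod_eq_hodgeClasses_of_finrank_eq_two h2₁)

variable {κ : Type*} [Fintype κ] [DecidableEq κ] {E' : Type u} [NormedAddCommGroup E'] [InnerProductSpace ℂ E']
  [FiniteDimensional ℂ E'] [MeasurableSpace E'] [BorelSpace E'] (Ψ : (κ → ℝ) ≃L[ℝ] E') {q : ℕ} (e : Fin q ≃ κ)

/-- **The Hodge `(p,p)`-conjecture in cycle form for every inner-product torus isogenous to a power of `S₁ × S₂`**, `S₁` a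
Hodge-general abelian surface, `S₂` any abelian surface with `End_ℚ(S₂) ≠ ℚ`.
[cite: MoonenZarhin1999LowDim, Thm. (0.2) (4) and §1 (1.5)] [cite: Lange2023AbelianVarietiesComplex, §7.3.1 (p. 336) and §7.3.3 Exercise (1)(b)] -/
theorem IsIsogenous.forall_analyticClasses_eq_hodgeClasses_of_powPeriod_prod_of_finrank_eq_two_of_endAlgRat_eq_bot_of_ne_bot
    {k : ℕ} (hY : IsIsogenous Ψ (powPeriod (prodPeriod Φ₁ Φ₂) k)) (hS₁ : IsAbelianVariety Φ₁) (h2₁ : finrank ℂ E₁ = 2)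
    (hE₁ : endAlgRat Φ₁ = ⊥) (hS₂ : IsAbelianVariety Φ₂) (h2₂ : finrank ℂ E₂ = 2) (hE₂ : endAlgRat Φ₂ ≠ ⊥) (p : ℕ) :
    analyticClasses Ψ e p = hodgeClasses Ψ p :=
  hY.forall_analyticClasses_eq_hodgeClasses_of_powPeriod_of_forall_powPeriod Ψ e (hS₁.prod hS₂)
    (hS₁.forall_divisorClasses_powPeriod_prod_eq_hodgeClasses_of_finrank_eq_two_of_endAlgRat_eq_bot_of_ne_bot Φ₂ h2₁ hE₁
      hS₂ h2₂ hE₂) p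

end Surfaces

/-! ## §3 Two abelian threefolds, `End_ℚ(T₁) = ℚ ≠ End_ℚ(T₂)` -/

section Threefolds

variable {ι₁ ι₂ : Type*} [Fintype ι₁] [DecidableEq ι₁] [Fintype ι₂] [DecidableEq ι₂]
  {E₁ E₂ : Type*} [NormedAddCommGroup E₁] [NormedSpace ℂ E₁] [FiniteDimensional ℂ E₁] [NormedAddCommGroup E₂]
  [NormedSpace ℂ E₂] [FiniteDimensional ℂ E₂] {Φ₁ : (ι₁ → ℝ) ≃L[ℝ] E₁} (Φ₂ : (ι₂ → ℝ) ≃L[ℝ] E₂)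

/-- **Two abelian threefolds with `End_ℚ(T₁) = ℚ ≠ End_ℚ(T₂)`: `Hg(T₁ × T₂)(ℂ) = Hg(T₁)(ℂ) × Hg(T₂)(ℂ)`** (`T₁` is Hodge-general:
(D) by Moonen–Zarhin (2.3), `g = 3`; `dim Hg(T₂) < 21`). [cite: MoonenZarhin1999LowDim, §2 (2.3), §3 (3.1) and §1] [cite: Gordon1997, §2.16 Proposition] -/
theorem IsAbelianVariety.hodgeGroupC_prod_eq_blockDiagProd_of_finrank_eq_three_of_endAlgRat_eq_bot_of_ne_bot
    (hT₁ : IsAbelianVariety Φ₁) (h3₁ : finrank ℂ E₁ = 3) (hE₁ : endAlgRat Φ₁ = ⊥) (hT₂ : IsAbelianVariety Φ₂)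
    (h3₂ : finrank ℂ E₂ = 3) (hE₂ : endAlgRat Φ₂ ≠ ⊥) :
    hodgeGroupC (prodPeriod Φ₁ Φ₂) = blockDiagProd (hodgeGroupC Φ₁) (hodgeGroupC Φ₂) := by
  haveI := nonempty_of_finrank_pos₁₃₀ Φ₁ (by omega)
  haveI := nonempty_of_finrank_pos₁₃₀ Φ₂ (by omega)
  exact hT₁.hodgeGroupC_prod_eq_blockDiagProd_of_endAlgRat_eq_bot_of_endAlgRat_ne_bot Φ₂ hE₁
    (hT₁.forall_divisorClasses_eq_hodgeClasses_powPeriod_of_finrank_eq_three_of_endAlgRat_eq_bot h3₁ hE₁) hT₂ hE₂ (by omega)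

/-- **`Hom_ℚ(T₁, T₂) = 0 = Hom_ℚ(T₂, T₁)` and `ρ(T₁ × T₂) = 1 + ρ(T₂)`** for such a pair of threefolds.
[cite: HulekLaface2019PicardNumbersAV, §2.1 Cor. 2.3] [cite: MoonenZarhin1999LowDim, §3 Prop. (3.8)] -/
theorem IsAbelianVariety.homRat_eq_bot_and_finrank_neronSeveriGroup_prod_of_finrank_eq_three_of_endAlgRat_eq_bot_of_ne_bot
    (hT₁ : IsAbelianVariety Φ₁) (h3₁ : finrank ℂ E₁ = 3) (hE₁ : endAlgRat Φ₁ = ⊥) (hT₂ : IsAbelianVariety Φ₂)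
    (h3₂ : finrank ℂ E₂ = 3) (hE₂ : endAlgRat Φ₂ ≠ ⊥) :
    (homRat Φ₁ Φ₂ = ⊥ ∧ homRat Φ₂ Φ₁ = ⊥) ∧
      finrank ℤ (neronSeveriGroup (prodPeriod Φ₁ Φ₂)) = 1 + finrank ℤ (neronSeveriGroup Φ₂) := by
  haveI := nonempty_of_finrank_pos₁₃₀ Φ₁ (by omega)
  haveI := nonempty_of_finrank_pos₁₃₀ Φ₂ (by omega)
  have hD₁ := hT₁.forall_divisorClasses_eq_hodgeClasses_powPeriod_of_finrank_eq_three_of_endAlgRat_eq_bot h3₁ hE₁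
  exact ⟨hT₁.homRat_eq_bot_and_of_endAlgRat_eq_bot_of_endAlgRat_ne_bot Φ₂ hE₁ hD₁ hT₂ hE₂ (by omega),
    hT₁.finrank_neronSeveriGroup_prod_of_endAlgRat_eq_bot_of_endAlgRat_ne_bot Φ₂ hE₁ hD₁ hT₂ hE₂ (by omega)⟩

/-- **(D) on all powers of the abelian sixfold `T₁ × T₂`** for such a pair, as soon as `T₂` satisfies (D) (e.g. `T₂` simple with
totally real or imaginary quadratic `End_ℚ`, by the tree's threefold theorems). [cite: MoonenZarhin1999LowDim, §3 (3.1) and Thm. (3.2) (1)]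
[cite: Gordon1999HodgeAVSurvey, Thm. 7.5 and Thm. 7.6.2] -/
theorem IsAbelianVariety.forall_divisorClasses_powPeriod_prod_eq_hodgeClasses_of_finrank_eq_three_of_endAlgRat_eq_bot_of_ne_bot
    (hT₁ : IsAbelianVariety Φ₁) (h3₁ : finrank ℂ E₁ = 3) (hE₁ : endAlgRat Φ₁ = ⊥) (hT₂ : IsAbelianVariety Φ₂)
    (h3₂ : finrank ℂ E₂ = 3) (hE₂ : endAlgRat Φ₂ ≠ ⊥)
    (hX₂ : ∀ k p, divisorClasses (powPeriod Φ₂ k) p = hodgeClasses (powPeriod Φ₂ k) p) :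
    ∀ k p, divisorClasses (powPeriod (prodPeriod Φ₁ Φ₂) k) p = hodgeClasses (powPeriod (prodPeriod Φ₁ Φ₂) k) p := by
  haveI := nonempty_of_finrank_pos₁₃₀ Φ₁ (by omega)
  haveI := nonempty_of_finrank_pos₁₃₀ Φ₂ (by omega)
  exact hT₁.forall_divisorClasses_powPeriod_prod_eq_hodgeClasses_of_endAlgRat_eq_bot_of_endAlgRat_ne_bot Φ₂ hE₁
    (hT₁.forall_divisorClasses_eq_hodgeClasses_powPeriod_of_finrank_eq_three_of_endAlgRat_eq_bot h3₁ hE₁) hT₂ hE₂ (by omega) hX₂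

end Threefolds

end ComplexTorus

end Literature.Geometry.Kaehler

end
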